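import Mathlib
import HarnessLib
import HarnessLib.Audit
import Summits.ValiantsHypothesis.Statement
import Literature.Computability.AlgebraicComplexity.DeterminantalComplexity
import Literature.Computability.AlgebraicComplexity.PermanentVsDeterminant
import Literature.Computability.AlgebraicComplexity.EquivariantDC
import HarnessLib.Audit.Status.Attr

/-!
Route: DetQP

# Route DetQP — determinantal complexity of the permanent beyond quasi-polynomial

It suffices to show X = DetqpThesis (target, rank 0): the affine determinantal complexity dc(per_n)
of the n×n permanent
over ℂ (`Literature.Computability.AlgebraicComplexity.determinantalComplexity`: the least m such
that per_n is the
determinant of an m×m matrix of affine-linear forms) is NOT quasi-polynomially bounded — there is no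
c with
dc(per_n) ≤ 2^((log₂ n + c)^c) for all n. This is the Extended Valiant Hypothesis "PER is not a
qp-projection of DET"
[BurgisserClausenShokrollahi1997 (21.41), Problem 21.5; Burgisser2000 §2.5] written in dc-language;
it is strictly
STRONGER than VH (it fails if dc(per_n) = n^O(log n), which is compatible with VP ≠ VNP) — the qp
form is chosen on
purpose because the poly form pnp.S05 (support DetqpSuperpoly) only yields VNP ⊄ VBP.
Lean: `¬ Literature.Computability.AlgebraicComplexity.IsQPBounded (fun n =>
Literature.Computability.AlgebraicComplexity.determinantalComplexity
(Literature.Computability.AlgebraicComplexity.perPoly (Fin n) ℂ))`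

Assembly X → ValiantsHypothesis. Deciding theorem (D-0027): `closes : DetqpThesis → DcqpToVH →
ValiantsHypothesis`,
modus ponens. The support item DcqpToVH (`¬ IsQPBounded (n ↦ dc(per_n)) → ValiantsHypothesis`,
shared with routes
PrincipalMinorColouring and GrenetZeon, stamped, candidate proofs on file, provable now) is the
textbook step:
VP ⊆ VQP = quasi-polynomial projections of DET [BurgisserClausenShokrollahi1997 Thm (21.27), Thm
(21.33),
Cor (21.40); in tree `isQPBounded_determinantalComplexity_of_isVPFamily_holds`], per ∈ VNP
[Valiant1979;
`perFamily_mem_VNP_holds`] and the renaming bridge `mem_VP_ofFintype_iff_holds`: if VP ℂ = VNP ℂ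
then per ∈ VP, so
dc(per_n) would be qp-bounded, contradicting X. (Repair 2026-08-15: the hub item HubPerNotVp 0317
and DetqpVpDcQp 0321 are dropped from this route as
superseded by DcqpToVH + closes — 0317 stays alive in the other routes wanting it, 0321 is now the
discharged
Literature fact isQPBounded_determinantalComplexity_of_isVPFamily; the legacy Assembly item 0316 —
the same
implication with the three facts kept as explicit hypotheses, shared with GCTMult — stays as a
provable-now
bookkeeping item (pure logic) and is no longer the deciding theorem.)

Rationale: WHY THIS LINE. It moves VH into the algebraic geometry of the two hypersurfaces {det_m = 0} and
{per_n = 0}: every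
unrestricted lower bound on dc(per_n) compares LOCAL differential invariants of the determinant
hypersurface at the
image point with those of the permanent — rank of the Hessian / Gauss map [MignonRessayre2004 Thm
1.1: dc(per_n) ≥ n²/2,
in tree sq_le_two_mul_determinantalComplexity_perPoly_complex_holds; CaiChenLi2010], dual varieties
[arXiv:1004.4802
Thm 1.0.1], singular locus [arXiv:1505.02205 Thm 1.2: dc(per_3) = 7] — and all of them saturate at
Θ(n²) [Landsberg2017
Rem 6.4.6.5]. Under symmetry the answer is known and exponential: equivariant dc(per_m) = C(2m,m) −
1, and ≥ 2^m − 1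
already for the left half of the symmetry group [arXiv:1508.05788 = LandsbergRessayre2017 Thms 2.1,
2.8; both lower
bounds PROVED in tree: lr_full_equivariant_lower_holds, lr_left_equivariant_lower_holds]. Hence two
engines: (a) a
differential invariant of {det_m = 0} of order ≥ 3 that is not a flattening rank (crux
DetqpSuperquadratic is its
first milestone), (b) "symmetrisation costs quasi-polynomially little" (crux DetqpSymmetrization),
which turns LR17
into X. Upper bound to beat: dc(per_n) ≤ 2^n − 1 [Grenet2011; fact
determinantalComplexity_perPoly_le]. Imported area:
singularity / invariant theory of hypersurfaces and the GIT of the symmetry groups G_det, G_per;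
what this line does
that sibling routes do not: it attacks unrestricted affine dc at qp scale directly (GCTMult is the
border /
representation-theoretic variant; PrincipalMinorColouring, ScaledPencil, GrenetZeon restrict the
representation).

RANKED CRUXES. #2 DetqpSuperquadratic — ∃ ε > 0 with dc(per_n) ≥ n^(2+ε) for all large n (why it
might fail: every
known engine saturates at Θ(n²) — Hessian rank MR04, dual-variety degeneracy LMR13, singular-locus
codimension ≤ 2n+1
for per ABV17 Rem 1.5 — nothing excludes dc(per_n) = O(n²), and flattening ranks hit ELSW18 once n >
2m²+2m; sources:
MignonRessayre2004 Thm 1.1, arXiv:1004.4802, arXiv:1505.02205, Landsberg2017 Thm 6.4.6.4 / Rem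
6.4.6.5,
EfremenkoLandsbergSchenckWeyman2018 Thm 1.5). Ranked hardest-and-most-informative: any ε > 0 breaks
the 2004 ceiling
and certifies a genuinely new invariant; it is a milestone of engine (a) and does NOT by itself
imply X.
#3 DetqpSymmetrization — for m ≥ 3 every affine determinantal representation of per_m of size s
yields one that is
equivariant for the left monomial symmetries (permutation × torus acting on rows) of size ≤ 2^((log₂
s + c)^c), c
absolute (why it might fail: the det-analogue is FALSE in the regular model — rdc(det_m) = O(m³) but
equivariant
regular representations need ≥ 2^m − 1 [arXiv:1610.00159; LandsbergRessayre2017 Thm 2.14] — so a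
proof must use
per-specific structure; and AS TYPED, combined with LR17 Thm 2.8, it forces dc(per_m) ≥ 2^(m^(1/c) −
c), far more
than X needs; sources: arXiv:1508.05788 Question 2.2, Cor 2.3, Thm 2.8, arXiv:1610.00159 §3). With
lr_left_equivariant_lower_holds it implies X.
Target #0 DetqpThesis = X. Support: #4 DetqpSuperpoly (pnp.S05 = DcPerSuperpolynomial ℂ, the
polynomial milestone,
weaker than X, ⟺ VNP ⊄ VBP over ℂ [MalodPortier2008; arXiv:2406.06217 p.12]); #9 DcqpToVH (X → VH,
provable now,
shared, the second hypothesis of `closes`); #9 NegPerInVp (per ∈ VP: the negation side of every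
permanent-based
route, ⟺ ¬VH [Burgisser2000 Rem 2.11], filed low so refuters hunt encoding artefacts — junk sInf
values, unbounded
fan-in — rather than a proof). #1 Assembly (stmt-0316, legacy, shared with GCTMult): the same
implication X → VH with the three
Literature facts kept as explicit hypotheses — pure logic, provable now, kept for the record; it was
read as the
deciding theorem while `closes` was missing (the glue.extra-hypothesis stamp) and is superseded in
that role by
`closes`. Dropped in the 2026-08-15 glue repair as superseded by DcqpToVH + closes: HubPerNotVp
(stmt-0317, the
shared hub, alive in the other permanent routes) and DetqpVpDcQp (stmt-0321, now literally the
ℂ-instance of the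
discharged Literature fact isQPBounded_determinantalComplexity_of_isVPFamily).

KILL CRITERIA. A proof that dc(per_n) ≤ 2^((log₂ n + c)^c) for some c — per_n a qp-projection of
DET, e.g. from a
quasi-polynomial ABP / skew circuit / formula for the permanent — refutes DetqpThesis and closes the
route
(`close --reason refuted:DetqpThesis`); VH would then survive only through separations invisible to
dc, and none is
on the table, so in practice it sinks every permanent-vs-determinant route of the summit. A theorem
that every local
differential invariant of {det_m = 0} of bounded order is polynomially bounded on the points coming
from per_n (an
ELSW18 / EGOW18-type barrier for hypersurface invariants, cf. the barrier
Literature.Barriers.ValiantsHypothesis.ShiftedPartialsCannotSeparate) kills engine (a) ⇒ pivot to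
(b). A family of determinantal representations of per_m
whose left-monomial symmetrisation provably needs size 2^(s^δ) refutes DetqpSymmetrization ⇒ pivot
to (a) or to the
weaker symmetrisation form of NOT DECOMPOSED YET (ii). A proof of NegPerInVp refutes the summit
statement itself.

NOT DECOMPOSED YET. (i) Which invariant replaces the Hessian — the cubic form on the kernel of the
Hessian along the
singular stratification of {det_m = 0}, Gauss-map fibre dimensions, higher fundamental forms,
Chow-form flattenings —
becomes children of DetqpSuperquadratic only after a candidate has been computed on per_n for small
n. (ii)
DetqpSymmetrization: the grounder asked to re-type it over the named subgroup
Literature.Computability.AlgebraicComplexity.leftMonomialSubst ℂ m (LandsbergRessayre.lean; the same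
subgroup as the
inline closure, so lr_left_equivariant_lower_holds applies without glue), and a refuter observed
that qp cost is
overkill: X already follows from symmetrisation at any cost e(s) = 2^(2^(g(log₂ log₂ s))) with g
sub-exponential,
uniformly in the representation. The tenure planner should restate the crux ONCE, in the weaker
named-subgroup form
(one restate, one re-stamping) — deliberately not done in this glue repair. (iii) The border /
multiplicity variant
is its own route (GCTMult); shape-restricted representations are PrincipalMinorColouring,
ScaledPencil, GrenetZeon;
no third engine is opened here. (iv) No sub-cruxes under DetqpSuperpoly: it is a milestone reached
through #2, not a
separate line.

CHEAPEST FALSIFIER. Statement level: a quasi-polynomial upper bound on dc(per_n) — nothing below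
Grenet's 2^n − 1 is
known for general n, so no lookup kills X today. Mechanism level, engine (b), cheapest real probe:
LR17 Thm 2.8 gives
left-equivariant size ≥ 2^m − 1, attained by Grenet; at m = 3 this equals dc(per_3) = 7
[arXiv:1505.02205], so
symmetrisation is free there; at m = 4, dc(per_4) ∈ [8, 15] is open — a kit search for affine
representations of
per_4 of size ≤ 14 with sparse support would, if successful, exhibit the first instance where
symmetrisation has a
cost and calibrate the cost function the crux must absorb (and sharpen NUMBERS either way). Engine
(a): evaluate the
candidate third-order invariant symbolically at the Mignon–Ressayre point y₀ = J − n·E₁₁ for n ≤ 6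
(kit); if it
carries nothing beyond the Hessian rank there — which Landsberg2017 Rem 6.4.6.5 predicts for naive
third derivatives —
the "third-order data" bet dies before any seat is spent.

NUMBERS. n²/2 ≤ dc(per_n) (n ≥ 3, char 0) [MignonRessayre2004]; dc(per_3) = 7 [arXiv:1505.02205];
dc(per_n) ≤ 2^n − 1
[Grenet2011]; equivariant: edc(per_m) = C(2m,m) − 1, left-equivariant ≥ 2^m − 1 (m ≥ 3)
[arXiv:1508.05788 Thms 2.1,
2.8]; rdc(det_m) = O(m³) [arXiv:1610.00159]; shifted partials cannot separate padded per_m from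
det_n once
n > 2m² + 2m [EfremenkoLandsbergSchenckWeyman2018 Thm 1.5].

SOURCES. Valiant1979, Burgisser2000, BurgisserClausenShokrollahi1997, MignonRessayre2004,
CaiChenLi2010,
arXiv:1505.02205 (AlperBogartVelasco2017), arXiv:1004.4802 (LandsbergManivelRessayre2013),
arXiv:1508.05788
(LandsbergRessayre2017), arXiv:1610.00159 (IkenmeyerLandsberg2017), Grenet2011, Landsberg2017,
MalodPortier2008,
EfremenkoLandsbergSchenckWeyman2018, arXiv:2406.06217 (Burgisser2024).

Novelty: NOVELTY (retriage draft, search-before-claim: `lit search --hybrid`, `lit search … --year-from 2015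
--source all`, `lit frontier ValiantsHypothesis --since 2020`, `lit read` of the items below).
Thesis X itself is NOT new: it is the printed, open Extended Valiant Hypothesis "PER is not a
qp-projection of DET" [BurgisserClausenShokrollahi1997 (21.41) p.598, Problem 21.5 p.605;
Burgisser2000 §2.5/§8] written in dc-language; the Assembly X → VH via VP ⊆ VQP = qp-projections of
DET [BCS97 Thm (21.27), (21.33), Cor (21.40)] is textbook (fact
isQPBounded_determinantalComplexity_of_isVPFamily, discharged in tree).
Nearest prior art per engine:
(a) "invariants of {det_n = 0} beyond the Hessian": Mignon–Ressayre 2004 Thm 1.1 (n²/2, Hessian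
rank); Landsberg–Manivel–Ressayre 2013 arXiv:1004.4802 Thm 1.0.1 (dual varieties, border m²/2);
Alper–Bogart–Velasco 2017 arXiv:1505.02205 Thm 1.2/Rem 1.5 (singular locus, caps at 2n+1 for per;
dc(per_3)=7); Yabe arXiv:1504.00151 ((m−1)²+1 over ℝ); Cai–Chen–Li 2010 and Bedi–Suagee 2026
(doi:10.1007/s00224-025-10253-8) (quadratic bounds in other characteristics); Kumar–Volk 2022
arXiv:2009.02452 (dc(Σxᵢⁿ) ≥ 1.5n−3, first bound beyond "number of variables" for an explicit
polynomial, not for per); 2026 preprints arXiv:2606.11090 (symmetric dc of power sums via polar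
degree) and arXiv:2606.13628 (near-quadratic BORDER dc of Σxᵢⁿ via conormal specialization);
Landsberg 2017 book ch. 6–7 is the programme statement (Rem 6.4.6.5: "it does not appear to be  [refs: 10.1007/s00224-025-10253-8, 1004.4802, 1505.02205, 1504.00151, 2009.02452, 2606.11090, 2606.13628, 1508.05788, 1610.00159, 2601.09343, doi:10.1007/s00224-025-10253-8, BurgisserClausenShokrollahi1997, Burgisser2000, Landsberg2017]

Barriers (technique_class: hypersurface-invariants-beyond-Hessian; symmetrization-dc): BARRIERS (catalogue Literature/Barriers/ValiantsHypothesis/*, decls in namespace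
Literature.Barriers.ValiantsHypothesis).
APPLY to engine (a) (crux DetqpSuperquadratic, target DetqpThesis):
• ShiftedPartialsCannotSeparate (EfremenkoLandsbergSchenckWeyman2018 Thm 1.5; consequences
.not_separate/.not_separate_of_le): the method of (shifted) partial derivatives cannot separate the
padded permanent from det_n once n > 2m²+2m — i.e. no flattening-rank invariant of that class proves
dc or border-dc(per_m) super-quadratic. Evasion: the route's invariants are LOCAL differential
invariants of the hypersurface at its points (Gauss-map fibres / dual variety, higher fundamental
forms, singular locus), conditions quantified over Z(f), not ranks of a linear image of the form f;
MR04/LMR13 are of this local type and lie outside the ELSW class — but they saturate at m²/2 all the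
same (Landsberg2017 Rem 6.4.6.5), so escaping the class is necessary, not sufficient. Honest bet:
third-order local data of {det_n=0} (cubic form on the kernel of the Hessian along the singular
stratification) carries more than rank information.
• RankMethods (EfremenkoGargOliveiraWigderson2018 Thm 1.1/1.2; .not_tensorRankMethodProves,
.not_waringRankMethodProves) and RankLifting (GargMakamOliveiraWigderson2019;
.not_tkRankMethodProves): technique classes are tensor- /Waring-rank certifications, not dc —
formally DO NOT apply; but the sub-multiplicativity ceiling they formalise is exactly the thesis's
stated kill crit

History (route lifecycle, newest last):
- 2026-08-15T16:21:32Z · rev 3: dropped HubPerNotVp, DetqpVpDcQp — route-repair g2 (glue+schema+cone): add DcqpToVH (= stmt-ValiantsHypothesis-3786, shared with PrincipalMinorColouring/GrenetZeon, stamped, candidate proofs on f (planner-rbadge-ValiantsHypothesis-DetQP-1e8323d8-g2-0)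
- 2026-08-16T04:20:10Z · AUTO-CRUX (backfill): DetqpThesis — hypotheses of the deciding theorem that nothing in the route derives are cruxes (operator:999:1085951)

sub-problem: ValiantsHypothesis · status: open · opened planner-ValiantsHypothesis-Survey-0 2026-08-13T06:08:39Z · rev 3 · ledger route-ValiantsHypothesis-DetQP
GENERATED by the gate from the ledger (D-0016/17). Provers cite these decls: `theorem foo : Summit.ValiantsHypothesis.ValiantsHypothesis.Theses.DetQP.<Decl> := …` in Summits/ValiantsHypothesis/ValiantsHypothesis/Theorems/<Name>.lean.
-/

namespace Summit.ValiantsHypothesis.ValiantsHypothesis.Theses.DetQP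

open scoped BigOperators Topology Manifold Classical MeasureTheory ProbabilityTheory Matrix InnerProductSpace ComplexConjugate ContinuousMap
open Filter Set Function TopologicalSpace MeasureTheory

attribute [summit_statement] _root_.ValiantsHypothesis

open Literature.PNP

/-- item stmt-ValiantsHypothesis-0315 · crux (kind.auto-crux: conjecture-grade) · rank 0 · open · by planner
why it might fail: X = Extended Valiant Hypothesis (VNP ⊄ VQP) at k=ℂ in dc form [BCS97 (21.41), Problem 21.5: open], strictly STRONGER than VH: it fails if per_n is a qp-projection of DET, e.g. dc(per_n)=n^{O(log n)}, which is compatible with VP≠VNP. Unrestricted bounds are stuck at n²/2 ≤ dc(per_n) ≤ 2^n−1.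
sources: BurgisserClausenShokrollahi1997, (21.41) p.598 and Problem 21.5 p.605, MignonRessayre2004, Thm 1.1 (= fact Literature.CplxAlg.sq_le_two_mul_determinantalComplexity_perPoly_complex), Grenet2011 (= fact Literature.CplxAlg.determinantalComplexity_perPoly_le), arXiv:2406.06217, Thm 2.36, Landsberg2017, Conj 1.2.4.2
Thesis of route DetQP: no c with dc(per_n) <= 2^((log2 n + c)^c) for all n (affine determinantal
complexity, Literature.Computability.AlgebraicComplexity.determinantalComplexity). Strictly stronger
than pnp.S05 (poly form). Sources: MignonRessayre2004, LandsbergRessayre2017, Grenet2011,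
Burgisser2000 §2.5. -/
@[route_item "route-ValiantsHypothesis-DetQP", crux]
def DetqpThesis : Prop :=
  ¬ Literature.Computability.AlgebraicComplexity.IsQPBounded (fun n => Literature.Computability.AlgebraicComplexity.determinantalComplexity (Literature.Computability.AlgebraicComplexity.perPoly (Fin n) ℂ))

/-- item stmt-ValiantsHypothesis-0318 · crux · rank 2 · open · by planner
why it might fail: Every known engine saturates at Θ(n²): Hessian rank (MR04), dual-variety degeneracy (LMR13, also border), singular-locus codim ≤2n+1 for per (ABV17 Rem 1.5); Landsberg2017 Rem 6.4.6.5: three derivatives do not improve MR. Nothing excludes dc(per_n)=O(n²); flattening ranks also hit ELSW18 (n>2m²+2m).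
sources: MignonRessayre2004, Thm 1.1, arXiv:1004.4802 (Landsberg–Manivel–Ressayre 2013), Thm 1.0.1, arXiv:1505.02205 (AlperBogartVelasco2017), Thm 1.2, Cor 1.4, Rem 1.5, Landsberg2017, Thm 6.4.6.4 and Rem 6.4.6.5 (p.171), EfremenkoLandsbergSchenckWeyman2018, Thm 1.5 = Literature.Barriers.ValiantsHypothesis.ShiftedPartialsCannotSeparate, arXiv:2406.06217, Thm 2.36 (n²/2 still best, Yabe over ℝ aside)
Break the Hessian-rank ceiling: known dc(per_n) ≥ n^2/2 [MignonRessayre2004 Thm 1.1; CaiChenLi2010],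
dc(per_3)=7 [AlperBogartVelasco2017]; upper bound 2^n-1 [Grenet2011]. Any ε>0 requires a new
invariant of the determinant hypersurface (higher fundamental forms / singular-locus flattenings).
Most informative crux of the route. -/
@[route_item "route-ValiantsHypothesis-DetQP"]
def DetqpSuperquadratic : Prop :=
  ∃ ε : ℝ, 0 < ε ∧ ∃ n₀ : ℕ, ∀ n ≥ n₀, (n : ℝ) ^ (2 + ε) ≤ (Literature.Computability.AlgebraicComplexity.determinantalComplexity (Literature.Computability.AlgebraicComplexity.perPoly (Fin n) ℂ) : ℝ)

/-- item stmt-ValiantsHypothesis-0319 · crux · rank 3 · open · by planner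
why it might fail: Det-analogue is FALSE in the regular model: rdc(det_m)=O(m³) [IL17] but GL(E)-equivariant regular reps need ≥2^m−1 [LR17 Thm 2.14]: no general symmetrization principle; a proof must use per-specific structure. As typed (Grenet+LR17 Thm 2.8 in tree) it is equivalent to dc(per_m) ≥ 2^{m^{1/c}−c} ⊋ X.
sources: arXiv:1610.00159 (IkenmeyerLandsberg2017), Prop. rdc(det_m)=O(m^3), §3, arXiv:1508.05788 (LandsbergRessayre2017), Question 2.2, Cor 2.3, Thm 2.8, Thm 2.13-2.14, Question 2.18 (p.5-7), Literature.Computability.AlgebraicComplexity.lr_left_equivariant_lower_holds (LandsbergRessayreProofs.lean:204; LR17 Thm 2.8 PROVED in tree over leftMonomialSubst ℂ m, LandsbergRessayre.lean:75) and lr_full_equivariant_lower_holds (LandsbergRessayreThm21Proofs.lean:439), Grenet2011, Landsberg2017, Thm 7.4.1.1 (p.193)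
[needs_definition: equivariantDetComplexity] Informal (needs Literature def
`equivariantDetComplexity` / `IsEquivariantDetRepr`, [LandsbergRessayre2017 Def 1.1-1.3]): every
affine determinantal representation per_m = det(Λ + A(x)) of size s can be converted into one that
is equivariant for the left half Γ^L_{per_m} (permutation × torus acting on rows) of the symmetry
group of per_m, of size at most 2^((log s + c)^c) for an absolute c. Combined with the theorem
edc(per_m) = C(2m,m) - 1 ≥ 2^m [LandsbergRessayre2017 Thm 1] this yields X_DetQP. Kill: a family of
representations whose symmetrization provably needs size 2^(s^δ). -/
@[route_item "route-ValiantsHypothesis-DetQP"]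
def DetqpSymmetrization : Prop :=
  ∃ c : ℕ, ∀ (m s : ℕ), 3 ≤ m → Literature.Computability.AlgebraicComplexity.HasDetRepr (Literature.Computability.AlgebraicComplexity.perPoly (Fin m) ℂ) s → ∃ s' ≤ 2 ^ ((Nat.log 2 s + c) ^ c), Literature.Computability.AlgebraicComplexity.HasEquivariantDetRepr (Subgroup.closure {γ : Matrix.GeneralLinearGroup (Fin m × Fin m) ℂ | ∃ (π : Equiv.Perm (Fin m)) (d : Fin m → ℂ), (∀ i, d i ≠ 0) ∧ (γ : Matrix (Fin m × Fin m) (Fin m × Fin m) ℂ) = Matrix.kroneckerMap (· * ·) (π.permMatrix ℂ * Matrix.diagonal d) 1}) (Literature.Computability.AlgebraicComplexity.perPoly (Fin m) ℂ) s'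

/-- item stmt-ValiantsHypothesis-0320 · support · rank 4 · open · by planner
sources: Valiant1979, Landsberg2017, Conj 1.2.4.2 (p.24), arXiv:2406.06217, p.12 (VBP≠VNP iff dc(n) not p-bounded, char≠2)
Existing Prop Literature.Computability.AlgebraicComplexity.DcPerSuperpolynomial ℂ
[MulmuleySohoni2001 Conj 4.3 consequence; Burgisser2000 §2.5]: the polynomial milestone (equivalent
to VNP ⊄ VBP over C via MalodPortier2008/Toda). Weaker than X_DetQP; does not by itself give VH. -/
@[route_item "route-ValiantsHypothesis-DetQP"]
def DetqpSuperpoly : Prop :=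
  Literature.Computability.AlgebraicComplexity.DcPerSuperpolynomial ℂ

/-- item stmt-ValiantsHypothesis-0322 · support · rank 9 · open · by planner
sources: BurgisserClausenShokrollahi1997, (21.17) p.576, arXiv:2406.06217, p.10 ('It is unknown whether (PER_n) ∈ VP')
Negation side of every permanent-based route (equivalent to ¬ValiantsHypothesis by Burgisser2000 Rem
2.11). Filed at low rank so refuters can look for encoding artefacts in VP/VNP/complexity (junk
values of sInf, unbounded fan-in weighted sums) rather than for a proof. -/
@[route_item "route-ValiantsHypothesis-DetQP"]
def NegPerInVp : Prop :=
  Literature.Computability.AlgebraicComplexity.perFamily ℂ ∈ Literature.Computability.AlgebraicComplexity.VP ℂ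

/-- item stmt-ValiantsHypothesis-3786 · support · rank 9 · closed · proved by Summit.ValiantsHypothesis.Theorems.dcqpToVH_proof_detQP @ c90e9d25f66c (prover) · by planner
[support] glue (provable now from PROVED cone facts): dc(per_n) not qp-bounded ⇒ VP ℂ ≠ VNP ℂ,
composing isQPBounded_determinantalComplexity_of_isVPFamily_holds (VP ⊆ VQP = qp-projections of DET,
BCS97 (21.27)/(21.40)), mem_VP_ofFintype_iff_holds, perFamily_mem_VNP_holds and
Hub.valiantsHypothesis_of_not_isVPFamily_per (Theorems/HubHub.lean); = route DetQP's Assembly with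
its hypotheses discharged. [difficulty: provable-now] -/
@[route_item "route-ValiantsHypothesis-DetQP", crux]
def DcqpToVH : Prop :=
  ¬ Literature.Computability.AlgebraicComplexity.IsQPBounded (fun n => Literature.Computability.AlgebraicComplexity.determinantalComplexity (Literature.Computability.AlgebraicComplexity.perPoly (Fin n) ℂ)) → ValiantsHypothesis

-- `DcqpToVH` holds: proved by `Summit.ValiantsHypothesis.Theorems.dcqpToVH_proof_detQP` @ c90e9d25f66c (its module imports this route file, so no `_holds` link can be stated here).

/-- item stmt-ValiantsHypothesis-0316 · assembly · rank 1 · closed · proved by Summit.ValiantsHypothesis.ValiantsHypothesis.Theorems.gctMult_assembly_proof (prover) · by planner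
Assembly for DetQP with the two Literature facts inlined as hypotheses: (i) VP families have
quasi-polynomially bounded determinantal complexity [Burgisser2000 Prop 2.30 + VSBR1983], (ii) the
ofFintype renaming bridge for the permanent family, (iii) per ∈ VNP. Pure bookkeeping once (i) is
available. -/
@[route_item "route-ValiantsHypothesis-DetQP"]
def Assembly : Prop :=
  (∀ {σ : ℕ → Type} [∀ n, Fintype (σ n)] (f : ∀ n, MvPolynomial (σ n) ℂ), Literature.Computability.AlgebraicComplexity.IsVPFamily f → Literature.Computability.AlgebraicComplexity.IsQPBounded (fun n => Literature.Computability.AlgebraicComplexity.determinantalComplexity (f n))) → ¬ Literature.Computability.AlgebraicComplexity.IsQPBounded (fun n => Literature.Computability.AlgebraicComplexity.determinantalComplexity (Literature.Computability.AlgebraicComplexity.perPoly (Fin n) ℂ)) → (Literature.Computability.AlgebraicComplexity.perFamily ℂ ∈ Literature.Computability.AlgebraicComplexity.VP ℂ ↔ Literature.Computability.AlgebraicComplexity.IsVPFamily (fun n => Literature.Computability.AlgebraicComplexity.perPoly (Fin n) ℂ)) → Literature.Computability.AlgebraicComplexity.perFamily_mem_VNP ℂ → ValiantsHypothesis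

-- `Assembly` holds: proved by `Summit.ValiantsHypothesis.ValiantsHypothesis.Theorems.gctMult_assembly_proof` (its module imports this route file, so no `_holds` link can be stated here).

/-! D-0027 §2.1 — DECIDING THEOREM (planner-authored via `route open/edit --closes-file`; by planner-rbadge-ValiantsHypothesis-DetQP-1e8323d8-g2-0 2026-08-15T16:23:10Z):
its hypotheses are this route's items and its conclusion the sub-problem Statement (glue_lint), and it elaborates with this file. -/

@[closes "route-ValiantsHypothesis-DetQP"] theorem closes (h_DetqpThesis : DetqpThesis) (h_DcqpToVH : DcqpToVH) : _root_.ValiantsHypothesis :=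
  h_DcqpToVH h_DetqpThesis

end Summit.ValiantsHypothesis.ValiantsHypothesis.Theses.DetQP
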